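import Literature.Analysis.OperatorTheory.Enflo2023.Extras
import Literature.Analysis.OperatorTheory.Enflo2023.Lemma2
import HarnessLib

/-!
# Enflo 2023, v2 p.6 eq. (18): `ε ↦ ℓ_ε(T)` is continuous — the literal statement, kernel-checked

Source under adjudication: Per H. Enflo, *On the invariant subspace problem in Hilbert spaces*, arXiv:2305.15442 (v1
2023, v2 2024), bib key `Enflo2023` — a CLAIMED proof of the invariant subspace problem for operators on a separable
Hilbert space.  This file is part of the kernel-tight typing of the manuscript by the b2b-enflo repair cell
(formaliser 1, Part A: v2 eq. (1)–(27), the set-up, the constructions `V_y`, `ℓ'`, `[ ]x₀`, Lemma 1 and Case I/II of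
the main step).  It records what FOLLOWS (proved implications from the manuscript's displayed hypotheses) and, where a
step does not follow, the typed inference together with its refutation.  NOTHING here asserts that the manuscript's
main theorem holds; no declaration concludes the invariant subspace problem for an arbitrary operator.  Value
(BLOCK-2b): theorems / refutations of typed inferences about a text — not progress on the problem.

THE CLAIM (v2 p.6, tex L215–L218): "with `ℓ_ε(T)` having minimal `‖·‖₂`-norm for `ℓ` with `‖x₀ − ℓ(T)y‖ ≤ ε`, we get
from (14) that (18) `ε → ℓ_ε(T)` is a continuous function."  `Extras.lean` (row A15 of the cell's claim table) typed
the two ingredients — `IsMinimal.norm_le_of_le` (the minimal norm is non-increasing in `ε`) and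
`IsMinimal.parallelogram` (`‖ℓ_ε − ℓ_{ε'}‖² ≤ 2‖ℓ_ε‖² + 2‖ℓ_{ε'}‖² − 4‖ℓ_{(ε+ε')/2}‖²`) — and left the remaining step
("convex and monotone, hence continuous; hence `ℓ_ε → ℓ_{ε₀}`") in prose.  This file closes it, so that the display
(18) itself is a kernel theorem, in three layers:
* `combo_mem_feasible` — two-radius convexity of the constraint of (1): `s·a + t·b` is feasible at radius `sε + tε'`;
* `convexOn_norm_minimiser`, `antitoneOn_norm_minimiser`, `continuousOn_norm_minimiser` — on a convex set `U` of
  radii carrying minimal vectors `ℓ_ε`, `N(ε) := ‖ℓ_ε‖` is convex and non-increasing, hence continuous when `U` is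
  open (Mathlib's `ConvexOn.continuousOn`: a convex function on an open set of a finite-dimensional space);
* `continuousOn_minimiser_of_convex`, `continuousOn_minimiser` — **(18) for the coefficient vectors**: `ε ↦ ℓ_ε` is
  continuous on any OPEN set `U` of radii carrying minimal vectors (values in the abstract coefficient inner-product
  space `E`, completeness not needed; in the paper `E = ℓ²`), from the parallelogram bound and the continuity of `N` at `ε₀` and along the midpoints
  `(ε + ε₀)/2 → ε₀` (interval case), then localised to balls;  `exists_continuousOn_minimiser` packages it with
  existence and uniqueness (`exists_isMinimal`, `IsMinimal.unique`): if every radius of an open `U` is feasible, THE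
  map `ε ↦ ℓ_ε` exists on `U` and is continuous;
* `Vy.VopL`, `Vy.norm_Vop_le`, `Vy.continuous_Vop` — `b ↦ b(T) = Σ_j b_j T^j` (`Vy.Vop` of `Lemma2.lean`) is a bounded
  linear map `ℓ² → B(H)` of norm `≤ (1 − ‖T‖²)^{-1/2}` (`‖T‖ < 1`), in particular continuous;
* `Vy.eq18` — **(18) literally**: for `V = V_y` (eq. (2)) and the minimal vectors `ℓ_ε` on an open set of radii,
  `ε ↦ ℓ_ε(T)` is continuous into `B(H)` with the operator norm; `Vy.eq18_exists` (with existence and uniqueness);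
  `Vy.eq18_Ioi` — HYPOTHESIS-FREE on the paper's objects: for every `T` with `‖T‖ < 1` and all `x₀, y`, the minimal
  vectors exist at every radius `ε > ‖x₀ − y‖` and `ε ↦ ℓ_ε`, `ε ↦ ℓ_ε(T)` are continuous on `(‖x₀ − y‖, ∞)`.
VERDICT for the record: (18) FOLLOWS — here from the convexity of the extremal problem (1).  The text's "from (14)"
would go through the Lagrange-multiplier parametrisation `C ↦ ℓ` of (5)/(14) (`V_y ℓ = V_yV_y^*(I + V_yV_y^*)^{-1}x₀`,
`y = C^{1/2}y'`) together with a monotone correspondence `ε ↔ C` that the text does not spell out; the convexity route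
needs neither.  The manuscript never cites (18) by number afterwards (radii are moved qualitatively on pp.9–13);
nothing downstream changes.
Origin: planner-b2b-enflo-1-g17-0 (formaliser 1, gen 17), 2026-08-19.  Imports `…Enflo2023.Extras` (the two
ingredients, over `…MinimalVector`/`…MinimalNorm`) and `…Enflo2023.Lemma2` (`Vy.Vop`); Mathlib
(`ConvexOn.continuousOn`, `squeeze_zero'`, `Filter.Tendsto.sqrt`).
-/

noncomputable section

open scoped InnerProductSpace Topology
open Filter ContinuousLinearMap

namespace Literature.Analysis.OperatorTheory.Enflo2023

section coefficient

variable {E H : Type*} [NormedAddCommGroup E] [InnerProductSpace ℂ E]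
  [NormedAddCommGroup H] [InnerProductSpace ℂ H]

/-- Two-radius convexity of the constraint of (1): if `‖x₀ − V a‖ ≤ ε`, `‖x₀ − V b‖ ≤ ε'` and `s, t ≥ 0`, `s + t = 1`,
then `‖x₀ − V(s a + t b)‖ ≤ sε + tε'` (real weights written as complex scalars). [cite: Enflo2023, v2 p.2, eq. (1)] -/
lemma combo_mem_feasible (V : E →L[ℂ] H) (x₀ : H) {ε ε' : ℝ} {a b : E}
    (ha : a ∈ feasible V x₀ ε) (hb : b ∈ feasible V x₀ ε') {s t : ℝ} (hs : 0 ≤ s) (ht : 0 ≤ t)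
    (hst : s + t = 1) : (s : ℂ) • a + (t : ℂ) • b ∈ feasible V x₀ (s * ε + t * ε') := by
  simp only [feasible, Set.mem_setOf_eq] at ha hb ⊢
  have hsplit : x₀ - V ((s : ℂ) • a + (t : ℂ) • b) = (s : ℂ) • (x₀ - V a) + (t : ℂ) • (x₀ - V b) := by
    have hx : x₀ = (s : ℂ) • x₀ + (t : ℂ) • x₀ := by
      rw [← add_smul]; norm_cast; rw [hst]; simp
    rw [map_add, map_smul, map_smul]
    conv_lhs => rw [hx]
    simp only [smul_sub]; abel
  rw [hsplit]
  calc ‖(s : ℂ) • (x₀ - V a) + (t : ℂ) • (x₀ - V b)‖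
      ≤ ‖(s : ℂ) • (x₀ - V a)‖ + ‖(t : ℂ) • (x₀ - V b)‖ := norm_add_le _ _
    _ = s * ‖x₀ - V a‖ + t * ‖x₀ - V b‖ := by
        rw [norm_smul, norm_smul, Complex.norm_real, Complex.norm_real, Real.norm_of_nonneg hs,
          Real.norm_of_nonneg ht]
    _ ≤ s * ε + t * ε' := add_le_add (mul_le_mul_of_nonneg_left ha hs) (mul_le_mul_of_nonneg_left hb ht)

variable {V : E →L[ℂ] H} {x₀ : H} {U : Set ℝ} {ℓ : ℝ → E}

/-- (18), step 1: if `ℓ_ε` is the minimal vector of (1) at every radius `ε` of a convex set `U`, then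
`N(ε) := ‖ℓ_ε‖` is CONVEX on `U` (the combination `s ℓ_ε + t ℓ_{ε'}` is feasible at radius `sε + tε'`). [cite: Enflo2023, v2 p.6, eq. (18)] -/
theorem convexOn_norm_minimiser (hUc : Convex ℝ U) (hℓ : ∀ ε ∈ U, IsMinimal V x₀ ε (ℓ ε)) :
    ConvexOn ℝ U (fun ε => ‖ℓ ε‖) := by
  refine ⟨hUc, ?_⟩
  intro ε hε ε' hε' s t hs ht hst
  have hmem : s • ε + t • ε' ∈ U := hUc hε hε' hs ht hst
  have hfeas : (s : ℂ) • ℓ ε + (t : ℂ) • ℓ ε' ∈ feasible V x₀ (s * ε + t * ε') :=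
    combo_mem_feasible V x₀ (hℓ ε hε).1 (hℓ ε' hε').1 hs ht hst
  have hmin : ‖ℓ (s • ε + t • ε')‖ ≤ ‖(s : ℂ) • ℓ ε + (t : ℂ) • ℓ ε'‖ :=
    (hℓ _ hmem).2 _ (by simpa only [smul_eq_mul] using hfeas)
  calc ‖ℓ (s • ε + t • ε')‖ ≤ ‖(s : ℂ) • ℓ ε + (t : ℂ) • ℓ ε'‖ := hmin
    _ ≤ ‖(s : ℂ) • ℓ ε‖ + ‖(t : ℂ) • ℓ ε'‖ := norm_add_le _ _
    _ = s • ‖ℓ ε‖ + t • ‖ℓ ε'‖ := by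
        rw [norm_smul, norm_smul, Complex.norm_real, Complex.norm_real, Real.norm_of_nonneg hs,
          Real.norm_of_nonneg ht, smul_eq_mul, smul_eq_mul]

/-- (18), step 1': `N(ε) = ‖ℓ_ε‖` is NON-INCREASING on `U` (a larger radius admits the smaller radius' minimiser;
`IsMinimal.norm_le_of_le`). [cite: Enflo2023, v2 p.6, eq. (18)] -/
theorem antitoneOn_norm_minimiser (hℓ : ∀ ε ∈ U, IsMinimal V x₀ ε (ℓ ε)) :
    AntitoneOn (fun ε => ‖ℓ ε‖) U :=
  fun ε hε ε' hε' hle => (hℓ ε hε).norm_le_of_le (hℓ ε' hε') hle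

/-- (18), step 2: on an OPEN convex set of radii (an open interval) `N(ε) = ‖ℓ_ε‖` is continuous — a convex function
on an open subset of `ℝ` is continuous (Mathlib `ConvexOn.continuousOn`). [cite: Enflo2023, v2 p.6, eq. (18)] -/
theorem continuousOn_norm_minimiser (hU : IsOpen U) (hUc : Convex ℝ U)
    (hℓ : ∀ ε ∈ U, IsMinimal V x₀ ε (ℓ ε)) : ContinuousOn (fun ε => ‖ℓ ε‖) U :=
  (convexOn_norm_minimiser hUc hℓ).continuousOn hU

/-- (18), step 3 (on an open interval): if `ℓ_ε` is the minimal vector of (1) at every radius of an open convex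
set `U`, then `ε ↦ ℓ_ε` is continuous on `U`: by `IsMinimal.parallelogram`,
`‖ℓ_ε − ℓ_{ε₀}‖² ≤ 2N(ε)² + 2N(ε₀)² − 4N((ε+ε₀)/2)² → 0` as `ε → ε₀`, `N` being continuous at `ε₀` (step 2). [cite: Enflo2023, v2 p.6, eq. (18)] -/
theorem continuousOn_minimiser_of_convex (hU : IsOpen U) (hUc : Convex ℝ U)
    (hℓ : ∀ ε ∈ U, IsMinimal V x₀ ε (ℓ ε)) : ContinuousOn ℓ U := by
  have hN : ContinuousOn (fun ε => ‖ℓ ε‖) U := continuousOn_norm_minimiser hU hUc hℓ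
  intro ε₀ hε₀
  -- midpoints of radii in `U` stay in `U`
  have hmid : ∀ ε ∈ U, (ε + ε₀) / 2 ∈ U := fun ε hε => by
    have h := hUc hε hε₀ (by norm_num : (0 : ℝ) ≤ 1 / 2) (by norm_num : (0 : ℝ) ≤ 1 / 2) (by norm_num)
    have e : (1 / 2 : ℝ) • ε + (1 / 2 : ℝ) • ε₀ = (ε + ε₀) / 2 := by rw [smul_eq_mul, smul_eq_mul]; ring
    rw [e] at h
    exact h
  -- `N(ε) → N(ε₀)` and `N((ε + ε₀)/2) → N(ε₀)` as `ε → ε₀` within `U`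
  have h1 : Tendsto (fun ε => ‖ℓ ε‖) (𝓝[U] ε₀) (𝓝 ‖ℓ ε₀‖) := hN ε₀ hε₀
  have hφ : Tendsto (fun ε : ℝ => (ε + ε₀) / 2) (𝓝[U] ε₀) (𝓝[U] ε₀) := by
    have hc : ContinuousWithinAt (fun ε : ℝ => (ε + ε₀) / 2) U ε₀ :=
      ((continuous_id.add continuous_const).div_const 2).continuousWithinAt
    have h := hc.tendsto_nhdsWithin (fun ε hε => hmid ε hε)
    simp only [add_self_div_two] at h
    exact h
  have h2 : Tendsto (fun ε => ‖ℓ ((ε + ε₀) / 2)‖) (𝓝[U] ε₀) (𝓝 ‖ℓ ε₀‖) := h1.comp hφ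
  -- the parallelogram majorant tends to `2N₀² + 2N₀² − 4N₀² = 0`
  have hg : Tendsto (fun ε => 2 * ‖ℓ ε‖ ^ 2 + 2 * ‖ℓ ε₀‖ ^ 2 - 4 * ‖ℓ ((ε + ε₀) / 2)‖ ^ 2)
      (𝓝[U] ε₀) (𝓝 0) := by
    have h := (((h1.pow 2).const_mul 2).add
      (tendsto_const_nhds : Tendsto (fun _ : ℝ => 2 * ‖ℓ ε₀‖ ^ 2) (𝓝[U] ε₀) (𝓝 (2 * ‖ℓ ε₀‖ ^ 2)))).sub
      ((h2.pow 2).const_mul 4)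
    rw [show 2 * ‖ℓ ε₀‖ ^ 2 + 2 * ‖ℓ ε₀‖ ^ 2 - 4 * ‖ℓ ε₀‖ ^ 2 = (0 : ℝ) by ring] at h
    exact h
  -- squeeze `‖ℓ_ε − ℓ_{ε₀}‖²` between `0` and the majorant (valid for `ε ∈ U`)
  have hsq : Tendsto (fun ε => ‖ℓ ε - ℓ ε₀‖ ^ 2) (𝓝[U] ε₀) (𝓝 0) := by
    refine squeeze_zero' (Eventually.of_forall fun ε => sq_nonneg _) ?_ hg
    filter_upwards [self_mem_nhdsWithin] with ε hε
    exact (hℓ ε hε).parallelogram (hℓ ε₀ hε₀) (hℓ _ (hmid ε hε))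
  have hnorm : Tendsto (fun ε => ‖ℓ ε - ℓ ε₀‖) (𝓝[U] ε₀) (𝓝 0) := by
    have h := hsq.sqrt
    rw [Real.sqrt_zero] at h
    exact h.congr (fun ε => Real.sqrt_sq (norm_nonneg _))
  exact tendsto_iff_norm_sub_tendsto_zero.2 hnorm

/-- **(18) for the coefficient vectors.**  If `ℓ_ε` is the minimal vector of (1) at every radius `ε` of an OPEN set
`U` of radii, then `ε ↦ ℓ_ε` is continuous on `U` (continuity is local: apply the interval version on a ball
around each `ε₀ ∈ U`). [cite: Enflo2023, v2 p.6, eq. (18)] -/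
theorem continuousOn_minimiser (hU : IsOpen U) (hℓ : ∀ ε ∈ U, IsMinimal V x₀ ε (ℓ ε)) :
    ContinuousOn ℓ U := by
  intro ε₀ hε₀
  obtain ⟨δ, hδ, hball⟩ := Metric.isOpen_iff.1 hU ε₀ hε₀
  have hB : ContinuousOn ℓ (Metric.ball ε₀ δ) :=
    continuousOn_minimiser_of_convex Metric.isOpen_ball (convex_ball ε₀ δ) fun ε hε => hℓ ε (hball hε)
  exact (hB.continuousAt (Metric.ball_mem_nhds ε₀ hδ)).continuousWithinAt

/-- **(18) with existence and uniqueness.**  If every radius of an open set `U` is feasible for (1) (and the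
coefficient space is complete), then THE minimal-vector map `ε ↦ ℓ_ε` exists on `U` (`exists_isMinimal`), is
determined (`IsMinimal.unique`) and is continuous on `U`. [cite: Enflo2023, v2 p.6, eq. (18)] -/
theorem exists_continuousOn_minimiser [CompleteSpace E] (V : E →L[ℂ] H) (x₀ : H) {U : Set ℝ}
    (hU : IsOpen U) (hne : ∀ ε ∈ U, (feasible V x₀ ε).Nonempty) :
    ∃ ℓ : ℝ → E, (∀ ε ∈ U, IsMinimal V x₀ ε (ℓ ε)) ∧
      (∀ ε ∈ U, ∀ a, IsMinimal V x₀ ε a → a = ℓ ε) ∧ ContinuousOn ℓ U := by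
  classical
  let ℓ : ℝ → E := fun ε => if h : ε ∈ U then Classical.choose (exists_isMinimal V x₀ ε (hne ε h)) else 0
  have hsel : ∀ ε ∈ U, IsMinimal V x₀ ε (ℓ ε) := fun ε hε => by
    simp only [ℓ, dif_pos hε]
    exact Classical.choose_spec (exists_isMinimal V x₀ ε (hne ε hε))
  exact ⟨ℓ, hsel, fun ε hε a ha => ha.unique (hsel ε hε), continuousOn_minimiser hU hsel⟩

end coefficient

section operator

variable {H : Type*} [NormedAddCommGroup H] [InnerProductSpace ℂ H] [CompleteSpace H]

namespace Vy

/-- `‖b(T)‖_op ≤ (1 − ‖T‖²)^{-1/2}‖b‖₂` for `b(T) = Σ_j b_j T^j`, `‖T‖ < 1` (Cauchy–Schwarz against the geometric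
series). [cite: Enflo2023, v2 p.2, eq. (2)] -/
lemma norm_Vop_le (T : H →L[ℂ] H) (hT : ‖T‖ < 1) (b : ℓ2) :
    ‖Vop T hT b‖ ≤ Real.sqrt (1 / (1 - ‖T‖ ^ 2)) * ‖b‖ :=
  LinearMap.mkContinuous_norm_le _ (by positivity) _

/-- **`b ↦ b(T)` as a bounded linear map `ℓ² → B(H)`** (linear in the coefficient vector, bounded by
`norm_Vop_le`). [cite: Enflo2023, v2 p.2, eq. (2)] -/
def VopL (T : H →L[ℂ] H) (hT : ‖T‖ < 1) : ℓ2 →L[ℂ] (H →L[ℂ] H) :=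
  LinearMap.mkContinuous
    { toFun := fun b => Vop T hT b
      map_add' := fun b b' => by
        ext v
        simp only [_root_.add_apply, Vop_apply, map_add]
      map_smul' := fun c b => by
        ext v
        simp only [RingHom.id_apply, _root_.smul_apply, Vop_apply, map_smul] }
    (Real.sqrt (1 / (1 - ‖T‖ ^ 2)))
    (norm_Vop_le T hT)

/-- Unfolding `VopL`: `VopL b = b(T)`. [cite: Enflo2023, v2 p.2, eq. (2)] -/
@[simp] lemma VopL_apply (T : H →L[ℂ] H) (hT : ‖T‖ < 1) (b : ℓ2) : VopL T hT b = Vop T hT b := rfl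

/-- `‖b ↦ b(T)‖ ≤ (1 − ‖T‖²)^{-1/2}`. [cite: Enflo2023, v2 p.2, eq. (2)] -/
lemma norm_VopL_le (T : H →L[ℂ] H) (hT : ‖T‖ < 1) :
    ‖VopL T hT‖ ≤ Real.sqrt (1 / (1 - ‖T‖ ^ 2)) :=
  LinearMap.mkContinuous_norm_le _ (by positivity) _

/-- `b(T) − b'(T) = (b − b')(T)`. [cite: Enflo2023, v2 p.2, eq. (2)] -/
lemma Vop_sub (T : H →L[ℂ] H) (hT : ‖T‖ < 1) (b b' : ℓ2) :
    Vop T hT b - Vop T hT b' = Vop T hT (b - b') := by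
  rw [← VopL_apply, ← VopL_apply, ← VopL_apply, map_sub]

/-- Lipschitz dependence of `b(T)` on the coefficient vector:
`‖b(T) − b'(T)‖_op ≤ (1 − ‖T‖²)^{-1/2}‖b − b'‖₂`. [cite: Enflo2023, v2 p.2, eq. (2)] -/
lemma norm_Vop_sub_le (T : H →L[ℂ] H) (hT : ‖T‖ < 1) (b b' : ℓ2) :
    ‖Vop T hT b - Vop T hT b'‖ ≤ Real.sqrt (1 / (1 - ‖T‖ ^ 2)) * ‖b - b'‖ := by
  rw [Vop_sub]
  exact norm_Vop_le T hT _

/-- `b ↦ b(T)` is continuous `ℓ² → B(H)` (operator norm). [cite: Enflo2023, v2 p.2, eq. (2)] -/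
theorem continuous_Vop (T : H →L[ℂ] H) (hT : ‖T‖ < 1) : Continuous fun b : ℓ2 => Vop T hT b :=
  (VopL T hT).continuous

/-- **(18), literally: `ε ↦ ℓ_ε(T)` is a continuous function.**  For `V = V_y` (eq. (2)) and the minimal vectors
`ℓ_ε ∈ ℓ²` of (1) at the radii of an open interval `U`, the operator-valued map `ε ↦ ℓ_ε(T) = Σ_j (ℓ_ε)_j T^j` is
continuous on `U` in operator norm — the composition of (18) for the coefficients (`continuousOn_minimiser`) with the
bounded linear map `b ↦ b(T)`.  It follows from convexity of (1), not "from (14)" as the text has it. [cite: Enflo2023, v2 p.6, eq. (18)] -/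
theorem eq18 (T : H →L[ℂ] H) (hT : ‖T‖ < 1) (y x₀ : H) {U : Set ℝ} (hU : IsOpen U)
    {ℓ : ℝ → ℓ2} (hℓ : ∀ ε ∈ U, IsMinimal (V T hT y) x₀ ε (ℓ ε)) :
    ContinuousOn (fun ε => Vop T hT (ℓ ε)) U :=
  (continuous_Vop T hT).comp_continuousOn (continuousOn_minimiser hU hℓ)

/-- (18) with existence: if every radius of an open interval `U` is feasible (`‖x₀ − V_y a‖ ≤ ε` solvable), the
minimal-vector map `ε ↦ ℓ_ε` exists and is unique on `U`, and both `ε ↦ ℓ_ε` (in `ℓ²`) and `ε ↦ ℓ_ε(T)` (in `B(H)`)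
are continuous on `U`. [cite: Enflo2023, v2 p.6, eq. (18)] -/
theorem eq18_exists (T : H →L[ℂ] H) (hT : ‖T‖ < 1) (y x₀ : H) {U : Set ℝ} (hU : IsOpen U)
    (hne : ∀ ε ∈ U, (feasible (V T hT y) x₀ ε).Nonempty) :
    ∃ ℓ : ℝ → ℓ2, (∀ ε ∈ U, IsMinimal (V T hT y) x₀ ε (ℓ ε)) ∧
      (∀ ε ∈ U, ∀ a, IsMinimal (V T hT y) x₀ ε a → a = ℓ ε) ∧
      ContinuousOn ℓ U ∧ ContinuousOn (fun ε => Vop T hT (ℓ ε)) U := by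
  obtain ⟨ℓ, hsel, huniq, hcont⟩ := exists_continuousOn_minimiser (V T hT y) x₀ hU hne
  exact ⟨ℓ, hsel, huniq, hcont, eq18 T hT y x₀ hU hsel⟩

/-- **(18) on the paper's objects, hypothesis-free.**  For ANY bounded `T` with `‖T‖ < 1` and any `x₀, y`: at every
radius `ε > ‖x₀ − y‖` problem (1) for `V_y` is feasible (`a = e₀` gives `V_y e₀ = y`), so the minimal vectors `ℓ_ε`
exist and are unique there, and `ε ↦ ℓ_ε` (in `ℓ²`) and `ε ↦ ℓ_ε(T)` (in `B(H)`) are continuous on the open half-line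
`(‖x₀ − y‖, ∞)` — which contains the text's radii `‖x₀ − y'‖ ≤ ε < 1 = ‖x₀‖` except the endpoint. [cite: Enflo2023, v2 p.6, eq. (18)] -/
theorem eq18_Ioi (T : H →L[ℂ] H) (hT : ‖T‖ < 1) (y x₀ : H) :
    ∃ ℓ : ℝ → ℓ2, (∀ ε ∈ Set.Ioi ‖x₀ - y‖, IsMinimal (V T hT y) x₀ ε (ℓ ε)) ∧
      (∀ ε ∈ Set.Ioi ‖x₀ - y‖, ∀ a, IsMinimal (V T hT y) x₀ ε a → a = ℓ ε) ∧
      ContinuousOn ℓ (Set.Ioi ‖x₀ - y‖) ∧ ContinuousOn (fun ε => Vop T hT (ℓ ε)) (Set.Ioi ‖x₀ - y‖) := by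
  refine eq18_exists T hT y x₀ isOpen_Ioi fun ε hε => ⟨lp.single 2 0 (1 : ℂ), ?_⟩
  rw [mem_feasible, V_single, pow_zero, one_apply_eq_self]
  exact le_of_lt hε

end Vy

end operator

end Literature.Analysis.OperatorTheory.Enflo2023

end
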